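import Literature.AnabelianGeometry.EtaleTheta.GalSectCuspPairTorsors
import HarnessLib

/-!
# [EtTh] Cor. 2.8 (ii) "preserved by `γ`": the image cusp — equivariance of the cuspidal pairs
# `cuspPairAt` under automorphisms of `Π^tp_C` (proof-only companion of `GalSectCuspPairTorsors.lean`)

Mochizuki, *The étale theta function …* [EtTh], Publ. RIMS **45** (2009), Cor. 2.8 (ii) p.268 (PRIMS PDF
p.42), with Cor. 2.9 p.269 for the cusp dictionary [cite: MochizukiEtTh2009, Cor 2.8 (ii) p.42].  abc-iut
cell, layer L2, ROW (B) companion (seat abc-iut-w5-d062 gen 2).  PROOF-ONLY (no definitions, no named facts).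

In `Cor28iiAt` the conclusion "`Γ` carries the structure at the cusp `g` to the structure at SOME cusp
`g'`" leaves `g'` existential.  Here: for an automorphism `Γ` of `Π^tp_C` stabilising the member
`S = Π^tp_Z`, the cusp stabiliser `D_C = T.cuspStabC` (as in t2's `Cor29_preserved`) and the geometric
group `Δ^tp_C`, the image of the cuspidal pair at `g` IS the cuspidal pair at `Γ g`
(`cuspPairAt_map_eq`) — so `g' = Γ g`.  Ingredients: an extensionality lemma for `GalSect.CuspPair`
and the conjugation/transport identity `Γ(g·H·g⁻¹) = Γ(g)·Γ(H)·Γ(g)⁻¹` (`map_conj_smul`).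

HONEST FRAMING: elementary; nothing here bears on [IUTchIII] Cor. 3.12; typed ≠ endorsed.
-/

namespace Literature.AnabelianGeometry.EtaleTheta

open scoped Pointwise

namespace GalSect

namespace CuspPair

variable {G : Type*} [Group G] [TopologicalSpace G]

/-- Two cuspidal pairs with the same `D` and `I` are equal. [cite: MochizukiGalSect2005, §4 p.33] -/
theorem ext' {P Q : CuspPair G} (hD : P.D = Q.D) (hI : P.I = Q.I) : P = Q := by
  cases P; cases Q; cases hD; cases hI; rfl

/-- `map` on the inertia group. [cite: MochizukiEtTh2009, Cor 2.8 (ii) p.42] -/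
theorem map_I {G' : Type*} [Group G'] [TopologicalSpace G'] (P : CuspPair G) (Γ : G ≃ₜ* G') :
    (P.map Γ).I = P.I.map Γ.toMulEquiv.toMonoidHom :=
  rfl

end CuspPair

/-- **Transport of a conjugate**: `Γ(g·H·g⁻¹) = Γ(g)·Γ(H)·Γ(g)⁻¹` for an isomorphism of groups `Γ`.
[cite: MochizukiEtTh2009, Cor 2.8 (ii) p.42] -/
theorem map_conj_smul {G G' : Type*} [Group G] [Group G'] (f : G →* G') (g : G) (H : Subgroup G) :
    (MulAut.conj g • H).map f = MulAut.conj (f g) • H.map f := by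
  ext y
  simp only [Subgroup.mem_map, Subgroup.mem_smul_pointwise_iff_exists, MulAut.smul_def,
    MulAut.conj_apply]
  constructor
  · rintro ⟨_, ⟨h, hh, rfl⟩, rfl⟩
    exact ⟨f h, ⟨h, hh, rfl⟩, by simp⟩
  · rintro ⟨_, ⟨h, hh, rfl⟩, rfl⟩
    exact ⟨g * h * g⁻¹, ⟨h, hh, rfl⟩, by simp⟩

end GalSect

namespace ThetaCovers

namespace TemperedCoverData

universe u

variable {l : ℕ} (T : TemperedCoverData.{u} l)

/-- **The image cusp.** For an automorphism `Γ` of `Π^tp_C` stabilising the member `S = Π^tp_Z`, the cusp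
stabiliser `D_C` and `Δ^tp_C`, the image of the cuspidal pair `(D_z, I_z)` at the cusp `g` is the cuspidal
pair at the cusp `Γ g`: `Γ(S ∩ g D_C g⁻¹) = S ∩ Γ(g) D_C Γ(g)⁻¹`, and likewise for the inertia — PROVED.
[cite: MochizukiEtTh2009, Cor 2.8 (ii) p.42] -/
theorem cuspPairAt_map_eq (S : Subgroup T.Gtp) (Γ : T.Gtp ≃ₜ* T.Gtp)
    (hS : S.map Γ.toMulEquiv.toMonoidHom = S)
    (hC : T.cuspStabC.map Γ.toMulEquiv.toMonoidHom = T.cuspStabC)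
    (hΔ : T.DeltaTp.map Γ.toMulEquiv.toMonoidHom = T.DeltaTp) (g : T.Gtp) :
    (T.cuspPairAt S g).map Γ = T.cuspPairAt S (Γ g) := by
  have hinj : Function.Injective Γ.toMulEquiv.toMonoidHom := Γ.toMulEquiv.injective
  have hD : (S ⊓ MulAut.conj g • T.cuspStabC).map Γ.toMulEquiv.toMonoidHom =
      S ⊓ MulAut.conj (Γ g) • T.cuspStabC := by
    rw [Subgroup.map_inf _ _ _ hinj, hS, GalSect.map_conj_smul, hC]
    rfl
  refine GalSect.CuspPair.ext' ?_ ?_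
  · exact hD
  · change ((S ⊓ MulAut.conj g • T.cuspStabC) ⊓ T.DeltaTp).map Γ.toMulEquiv.toMonoidHom =
      (S ⊓ MulAut.conj (Γ g) • T.cuspStabC) ⊓ T.DeltaTp
    rw [Subgroup.map_inf _ _ _ hinj, hD, hΔ]

/-- Hence, under the same hypotheses, "preserved by `γ`" between the cusps `g` and `Γ g` reduces to the
statement about member splittings: the `D`-clause of `PreservedBy` holds automatically — PROVED.
[cite: MochizukiEtTh2009, Cor 2.8 (ii) p.42] -/
theorem preservedBy_iff_members (S : Subgroup T.Gtp) (Γ : T.Gtp ≃ₜ* T.Gtp)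
    (hS : S.map Γ.toMulEquiv.toMonoidHom = S)
    (hC : T.cuspStabC.map Γ.toMulEquiv.toMonoidHom = T.cuspStabC)
    (hΔ : T.DeltaTp.map Γ.toMulEquiv.toMonoidHom = T.DeltaTp) (g : T.Gtp)
    (R : Set (T.cuspPairAt S g).SplittingClass) (R' : Set (T.cuspPairAt S (Γ g)).SplittingClass) :
    (T.cuspPairAt S g).PreservedBy (T.cuspPairAt S (Γ g)) Γ R R' ↔
      (fun S₀ => S₀.map Γ.toMulEquiv.toMonoidHom) '' (T.cuspPairAt S g).members R =
        (T.cuspPairAt S (Γ g)).members R' := by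
  have hD := congrArg GalSect.CuspPair.D (T.cuspPairAt_map_eq S Γ hS hC hΔ g)
  exact ⟨fun h => h.2, fun h => ⟨hD, h⟩⟩

/-- Images of member splittings at `g` are splittings at the image cusp `Γ g` — PROVED (so a
`Cor28iiAt`-style conclusion can always be checked member by member). [cite: MochizukiEtTh2009, Cor 2.8 (ii) p.42] -/
theorem map_members_subset_splittings (S : Subgroup T.Gtp) (Γ : T.Gtp ≃ₜ* T.Gtp)
    (hS : S.map Γ.toMulEquiv.toMonoidHom = S)
    (hC : T.cuspStabC.map Γ.toMulEquiv.toMonoidHom = T.cuspStabC)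
    (hΔ : T.DeltaTp.map Γ.toMulEquiv.toMonoidHom = T.DeltaTp) (g : T.Gtp)
    (R : Set (T.cuspPairAt S g).SplittingClass) :
    (fun S₀ => S₀.map Γ.toMulEquiv.toMonoidHom) '' (T.cuspPairAt S g).members R ⊆
      (T.cuspPairAt S (Γ g)).splittings := by
  rintro _ ⟨S₀, ⟨hS₀, -⟩, rfl⟩
  have := (T.cuspPairAt S g).map_mem_splittings Γ hS₀
  rwa [T.cuspPairAt_map_eq S Γ hS hC hΔ g] at this

end TemperedCoverData

end ThetaCovers

end Literature.AnabelianGeometry.EtaleTheta
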